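import Mathlib
import Summits.ValiantsHypothesis.ValiantsHypothesis.Theorems.KPlusLogSqLawWeakLiftingTowerGraftFoldLawAxisPair

/-!
# Tower graft line — THE FOLD LAW FOR EVERY RANK-TWO FAR LETTER: congruent indefinite letters (class-paid folds) and the definite
# companion (no folds)

Mechanism file for the line `Cruxes/WeakLifting/Lines/tower_graft.lean` (crux `WeakLifting` = stmt-ValiantsHypothesis-19561), memo
`Lines/tower_graft-S5.md` §1 (Ed) / §3 T3.  NO stub is claimed.  Companion of `…TowerGraftFoldLawAxisPair.lean` (`card_posRoots_foldDisc_le`: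
the fold discriminant of the axis-pair graft `Eᵢᵢ − Eⱼⱼ` is the product of two class determinants one size down, `Z₊ ≤ 2B`).

* `det_map_add_X_smul_axisPair`, `coeff_det_map_add_X_smul_axisPair` — the fibre quadratic IN AN INDETERMINATE (the memo's `Q(t,T) = det(G(t) + T·S)`
  for `S = Eᵢᵢ − Eⱼⱼ`, over any commutative ring): `Q = C(det G) + Y·C(adjᵢᵢ − adjⱼⱼ) − Y²·C(ε)`, coefficients `Q₀, Q₁, Q₂` by name.
* ★ `card_posRoots_foldDisc_congr_le` — **THE FOLD LAW FOR EVERY FAR LETTER CONGRUENT TO THE AXIS PAIR**, `S = R (Eᵢᵢ − Eⱼⱼ) Rᵀ` with `R` real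
  invertible (by Sylvester's law of inertia these are exactly the real symmetric letters of rank two and signature `(1,1)`, e.g. `uuᵀ − vvᵀ` with
  `u, v` independent): for the symmetric pencil `G = Σ X^{dₗ} Sₗ` of size `m+2` and `Q(Y) = det(G + Y·S) ∈ ℝ[X][Y]`, the fold discriminant
  `Q₁² − 4Q₀Q₂` has at most `2B` positive roots under `PosRootLawOn (m+1) K B d` (congruence by `R⁻¹`: same support, symmetric letters
  `R⁻¹ Sₗ R⁻ᵀ`, `Q` scales by `det(R)²`).
* `det_add_smul_single_add_smul_single`, ★ `definiteDisc_eq_sum_sq`, `definiteDisc_nonneg` — THE DEFINITE COMPANION `S = Eᵢᵢ + Eⱼⱼ` (hence, by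
  congruence, every PSD/NSD rank-two letter): `(adjᵢᵢ + adjⱼⱼ)² − 4·det G·ε = (adjᵢᵢ − adjⱼⱼ)² + 4·adjᵢⱼ²` — a SUM of two squares, non-negative at
  every real point: no transversal fold (the fibres of a semidefinite graft are real-rooted — memo §1, Rellich), double points = eigenvalue
  crossings `adjᵢᵢ = adjⱼⱼ ∧ adjᵢⱼ = 0`.

READING (T3 at rank two, complete): INDEFINITE rank two ⇒ folds are CLASS events, `#folds ≤ 2·ζ₊(m+1; d)`, factor 2, no additive term, no
exponent condition; DEFINITE rank two ⇒ no folds.  Together with (E0) `det G` and (Er) `det G[{i,j}ᶜ]` (both class determinants,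
`…FoldLawAxisPair.card_posRoots_pairMinor_le`) every event of the memo's §1 taxonomy is class-paid for rank-two grafts; the rank-two rung of S5
therefore needs exactly what the semidefinite rung S4 needs (T1/T2: the near-axis accounting of the phantoms) and nothing more.  Rank ≥ 3 with
mixed signature (isotropic cone not a union of hyperplanes) is the next honest piece of T3.
HONEST FRAMING: exact linear algebra; nothing on S4/S4b/S5/S5ᴸ, TowerB, `WeakLifting`, Conjecture B, `MatrixDescartes` (18050) or `VP ≠ VNP`.
Def-free.  Seat: prover val-sym-lift-p2 g21, `--supports stmt-ValiantsHypothesis-19561`.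
-/

-- `Summit.ValiantsHypothesis.ValiantsHypothesis.…` repeats a component by the D-0017 layout
-- (single-conjunct summit), which the `dupNamespace` linter flags; the name is mandated.
set_option linter.dupNamespace false

namespace Summit.ValiantsHypothesis.ValiantsHypothesis.Theorems.KPlusLogSqLaw.TowerGraft

open Polynomial Matrix
open scoped BigOperators Polynomial

section FoldLawBivariate

variable {A : Type*} [CommRing A]

/-- **THE FIBRE QUADRATIC IN AN INDETERMINATE.**  Over any commutative ring `A`, the graft polynomial `Q(Y) = det(G + Y·(Eᵢᵢ − Eⱼⱼ)) ∈ A[Y]`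
has coefficients `Q₀ = det G`, `Q₁ = adjᵢᵢ − adjⱼⱼ`, `Q₂ = −ε` and no others. [this work] -/
theorem det_map_add_X_smul_axisPair {n : Type*} [Fintype n] [DecidableEq n] (G : Matrix n n A) {i j : n} (hij : i ≠ j) :
    (G.map (C : A →+* A[X]) + (X : A[X]) • (Matrix.single i i (1 : A[X]) - Matrix.single j j (1 : A[X]))).det =
      C G.det + X * C (G.adjugate i i - G.adjugate j j) -
        X ^ 2 * C (((G.updateRow i (Pi.single i (1 : A))).updateRow j (Pi.single j (1 : A))).det) := by
  rw [smul_sub, ← add_sub_assoc, det_add_smul_single_sub_smul_single _ hij]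
  have h0 : (G.map (C : A →+* A[X])).det = C G.det := by
    rw [← RingHom.mapMatrix_apply, ← RingHom.map_det]
  have h1 : ∀ a : n, (G.map (C : A →+* A[X])).adjugate a a = C (G.adjugate a a) := by
    intro a
    rw [← RingHom.mapMatrix_apply, ← RingHom.map_adjugate, RingHom.mapMatrix_apply, Matrix.map_apply]
  have h2 : ((G.map (C : A →+* A[X])).updateRow i (Pi.single i (1 : A[X]))).updateRow j (Pi.single j (1 : A[X])) =
      (((G.updateRow i (Pi.single i (1 : A))).updateRow j (Pi.single j (1 : A)))).map (C : A →+* A[X]) := by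
    ext a b
    simp only [Matrix.map_apply, Matrix.updateRow_apply, Pi.single_apply]
    split_ifs <;> simp
  rw [h0, h1, h1, h2, ← RingHom.mapMatrix_apply, ← RingHom.map_det, map_sub]

/-- its three coefficients. [this work] -/
theorem coeff_det_map_add_X_smul_axisPair {n : Type*} [Fintype n] [DecidableEq n] (G : Matrix n n A) {i j : n} (hij : i ≠ j) :
    (G.map (C : A →+* A[X]) + (X : A[X]) • (Matrix.single i i (1 : A[X]) - Matrix.single j j (1 : A[X]))).det.coeff 0 = G.det ∧
    (G.map (C : A →+* A[X]) + (X : A[X]) • (Matrix.single i i (1 : A[X]) - Matrix.single j j (1 : A[X]))).det.coeff 1 =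
      G.adjugate i i - G.adjugate j j ∧
    (G.map (C : A →+* A[X]) + (X : A[X]) • (Matrix.single i i (1 : A[X]) - Matrix.single j j (1 : A[X]))).det.coeff 2 =
      -((G.updateRow i (Pi.single i (1 : A))).updateRow j (Pi.single j (1 : A))).det := by
  rw [det_map_add_X_smul_axisPair G hij]
  refine ⟨?_, ?_, ?_⟩
  · simp [coeff_C]
  · simp [coeff_C, coeff_X_pow]
  · simp [coeff_X_pow, coeff_X_mul]

end FoldLawBivariate

/-! ## The fold law for EVERY far letter congruent to the axis pair (all rank-two letters of signature `(1,1)`) -/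

section FoldLawCongruent

open Summit.ValiantsHypothesis.ValiantsHypothesis.Theorems.LacunarySymmetroidMatrixDescartes (PosRootLawOn)

/-- **THE FOLD LAW FOR A CONGRUENT FAR LETTER.**  Let `G = Σ X^{dₗ} Sₗ` be a symmetric pencil of size `m+2` and `S = R (Eᵢᵢ − Eⱼⱼ) Rᵀ` with `R`
real invertible (every real symmetric letter of rank two and signature `(1,1)` has this form, Sylvester).  Write the fibre quadratic in an
indeterminate, `Q(Y) = det(G + Y·S) = Q₀ + Q₁ Y + Q₂ Y² ∈ ℝ[X][Y]`.  Then the fold discriminant `Q₁² − 4 Q₀ Q₂ ∈ ℝ[X]` has at most `2B` positive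
roots under `PosRootLawOn (m+1) K B d`: congruence by `R⁻¹` carries `G` to the symmetric pencil with letters `R⁻¹ Sₗ R⁻ᵀ` (same support) and `S` to
the axis pair, and scales `Q` by `det(R)²`. [this work] -/
theorem card_posRoots_foldDisc_congr_le {m K B : ℕ} (d : Fin K → ℕ) (hB : PosRootLawOn (m + 1) K B d)
    (S : Fin K → Matrix (Fin (m + 2)) (Fin (m + 2)) ℝ) (hS : ∀ l, (S l).IsSymm) {i j : Fin (m + 2)} (hij : i ≠ j)
    (R : Matrix (Fin (m + 2)) (Fin (m + 2)) ℝ) (hR : R.det ≠ 0) :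
    let Q : ℝ[X][X] := ((∑ l, (X : ℝ[X]) ^ d l • (S l).map C).map (C : ℝ[X] →+* ℝ[X][X]) +
      (X : ℝ[X][X]) • (R * (Matrix.single i i (1 : ℝ) - Matrix.single j j (1 : ℝ)) * Rᵀ).map
        ((C : ℝ[X] →+* ℝ[X][X]).comp (C : ℝ →+* ℝ[X]))).det
    ((Q.coeff 1 ^ 2 - 4 * Q.coeff 0 * Q.coeff 2).roots.toFinset.filter (fun t => 0 < t)).card ≤ B + B := by
  intro Q
  classical
  -- the congruent pencil
  set T : Fin K → Matrix (Fin (m + 2)) (Fin (m + 2)) ℝ := fun l => (R⁻¹ᵀ)ᵀ * S l * R⁻¹ᵀ with hT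
  have hTsymm : ∀ l, (T l).IsSymm := fun l => isSymm_transpose_mul_mul _ (hS l)
  set G₁ : Matrix (Fin (m + 2)) (Fin (m + 2)) ℝ[X] := ∑ l, (X : ℝ[X]) ^ d l • (T l).map C with hG₁
  have hRinv : R * R⁻¹ = 1 := Matrix.mul_nonsing_inv R (isUnit_iff_ne_zero.mpr hR)
  have hRinv' : R⁻¹ * R = 1 := Matrix.nonsing_inv_mul R (isUnit_iff_ne_zero.mpr hR)
  -- (F1) `G = R · G₁ · Rᵀ` over `ℝ[X]`
  have hG : (∑ l, (X : ℝ[X]) ^ d l • (S l).map C) = R.map C * G₁ * (R.map C)ᵀ := by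
    rw [hG₁, ← transpose_mul_pencil_mul, ← Matrix.transpose_map, Matrix.transpose_transpose]
    have e1 : R.map (C : ℝ →+* ℝ[X]) * (R⁻¹).map C = 1 := by
      rw [← Matrix.map_mul, hRinv, Matrix.map_one _ (map_zero _) (map_one _)]
    have e2 : (R⁻¹)ᵀ.map (C : ℝ →+* ℝ[X]) * (R.map C)ᵀ = 1 := by
      rw [← Matrix.transpose_map, ← Matrix.map_mul, ← Matrix.transpose_mul, hRinv, Matrix.transpose_one,
        Matrix.map_one _ (map_zero _) (map_one _)]
    calc (∑ l, (X : ℝ[X]) ^ d l • (S l).map C)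
        = (R.map C * (R⁻¹).map C) * (∑ l, (X : ℝ[X]) ^ d l • (S l).map C) * ((R⁻¹)ᵀ.map C * (R.map C)ᵀ) := by
          rw [e1, e2, Matrix.one_mul, Matrix.mul_one]
      _ = R.map C * ((R⁻¹).map C * (∑ l, (X : ℝ[X]) ^ d l • (S l).map C) * (R⁻¹)ᵀ.map C) * (R.map C)ᵀ := by
          simp only [Matrix.mul_assoc]
  -- (F2) the fibre matrix is congruent to the axis-pair fibre matrix of `G₁`
  set CC : ℝ →+* ℝ[X][X] := (C : ℝ[X] →+* ℝ[X][X]).comp (C : ℝ →+* ℝ[X]) with hCC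
  have hQmat : ((∑ l, (X : ℝ[X]) ^ d l • (S l).map C).map (C : ℝ[X] →+* ℝ[X][X]) +
      (X : ℝ[X][X]) • (R * (Matrix.single i i (1 : ℝ) - Matrix.single j j (1 : ℝ)) * Rᵀ).map CC) =
      R.map CC * (G₁.map (C : ℝ[X] →+* ℝ[X][X]) +
        (X : ℝ[X][X]) • (Matrix.single i i (1 : ℝ[X][X]) - Matrix.single j j (1 : ℝ[X][X]))) * (R.map CC)ᵀ := by
    rw [Matrix.mul_add, Matrix.add_mul, Matrix.mul_smul, Matrix.smul_mul, hG, Matrix.map_mul, Matrix.map_mul,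
      ← Matrix.transpose_map, Matrix.map_map, Matrix.map_mul, Matrix.map_mul, ← Matrix.transpose_map,
      Matrix.map_sub _ (map_sub CC), Matrix.map_single, Matrix.map_single, map_one]
    rfl
  -- (F3) determinants and coefficients
  have hdetQ : Q = C (C (R.det ^ 2)) * (G₁.map (C : ℝ[X] →+* ℝ[X][X]) +
        (X : ℝ[X][X]) • (Matrix.single i i (1 : ℝ[X][X]) - Matrix.single j j (1 : ℝ[X][X]))).det := by
    show (_ : Matrix _ _ ℝ[X][X]).det = _
    rw [hQmat, Matrix.det_mul, Matrix.det_mul, Matrix.det_transpose]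
    have hdR : (R.map CC).det = C (C R.det) := by
      rw [← RingHom.mapMatrix_apply, ← RingHom.map_det, hCC, RingHom.comp_apply]
    rw [hdR, map_pow, map_pow]
    ring
  obtain ⟨h0, h1, h2⟩ := coeff_det_map_add_X_smul_axisPair G₁ hij
  have hc0 : Q.coeff 0 = C (R.det ^ 2) * G₁.det := by rw [hdetQ, coeff_C_mul, h0]
  have hc1 : Q.coeff 1 = C (R.det ^ 2) * (G₁.adjugate i i - G₁.adjugate j j) := by rw [hdetQ, coeff_C_mul, h1]
  have hc2 : Q.coeff 2 = C (R.det ^ 2) * -((G₁.updateRow i (Pi.single i 1)).updateRow j (Pi.single j 1)).det := by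
    rw [hdetQ, coeff_C_mul, h2]
  have hdisc : Q.coeff 1 ^ 2 - 4 * Q.coeff 0 * Q.coeff 2 = C ((R.det ^ 2) ^ 2) *
      ((G₁.adjugate i i - G₁.adjugate j j) ^ 2 -
        4 * G₁.det * -((G₁.updateRow i (Pi.single i 1)).updateRow j (Pi.single j 1)).det) := by
    rw [hc0, hc1, hc2]
    simp only [map_pow]
    ring
  have hc : (R.det ^ 2) ^ 2 ≠ 0 := pow_ne_zero _ (pow_ne_zero _ hR)
  rw [hdisc, Polynomial.roots_C_mul _ hc]
  exact card_posRoots_foldDisc_le d hB T hTsymm hij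

end FoldLawCongruent

/-! ## The DEFINITE rank-two companion: `S = Eᵢᵢ + Eⱼⱼ` — the discriminant is a SUM of two squares (no fold) -/

section DefinitePair

variable {n : Type*} [Fintype n] [DecidableEq n] {R : Type*} [CommRing R]

/-- digits of the definite axis-pair graft: `det(G + c·(Eᵢᵢ + Eⱼⱼ)) = det G + c·(adjᵢᵢ + adjⱼⱼ) + c²·ε`. [folklore] -/
theorem det_add_smul_single_add_smul_single (G : Matrix n n R) {i j : n} (hij : i ≠ j) (c : R) :
    (G + c • Matrix.single i i (1 : R) + c • Matrix.single j j (1 : R)).det =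
      G.det + c * (G.adjugate i i + G.adjugate j j) +
        c ^ 2 * ((G.updateRow i (Pi.single i (1 : R))).updateRow j (Pi.single j (1 : R))).det := by
  have e1 : G + c • Matrix.single i i (1 : R) + c • Matrix.single j j (1 : R) =
      (G + c • Matrix.single j j (1 : R)) + c • Matrix.single i i (1 : R) := by abel
  have h1 : (G + c • Matrix.single j j (1 : R)).det = G.det + c * G.adjugate j j := det_add_smul_single_eq_adjugate G j c
  have h2 : (G + c • Matrix.single j j (1 : R)).adjugate i i =
      G.adjugate i i + c * ((G.updateRow i (Pi.single i (1 : R))).updateRow j (Pi.single j (1 : R))).det := by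
    rw [Matrix.adjugate_apply, updateRow_add_smul_single G hij.symm, det_add_smul_single_eq_adjugate, Matrix.adjugate_apply,
      Matrix.adjugate_apply]
  rw [e1, det_add_smul_single_eq_adjugate, h1, h2]
  ring

/-- **DEFINITE PAIR: the discriminant is a sum of two squares** (symmetric `G`):
`(adjᵢᵢ + adjⱼⱼ)² − 4·det G·ε = (adjᵢᵢ − adjⱼⱼ)² + 4·adjᵢⱼ²` — so over `ℝ` the fibre quadratic of a positive-semidefinite rank-two graft never has a
transversal fold (real-rooted fibres, Rellich), and its double points are the common zeros of `adjᵢᵢ − adjⱼⱼ` and `adjᵢⱼ` (eigenvalue CROSSINGS,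
which do not spike the log-slope — memo §1). [this work] -/
theorem definiteDisc_eq_sum_sq {G : Matrix n n R} (hG : G.IsSymm) {i j : n} (hij : i ≠ j) :
    (G.adjugate i i + G.adjugate j j) ^ 2 -
        4 * G.det * ((G.updateRow i (Pi.single i (1 : R))).updateRow j (Pi.single j (1 : R))).det =
      (G.adjugate i i - G.adjugate j j) ^ 2 + 4 * G.adjugate i j ^ 2 := by
  have h1 := det_mul_det_pairMinor G hij
  rw [← adjugate_apply_comm_of_isSymm hG i j] at h1
  linear_combination (-4) * h1

/-- hence, over an ordered field (e.g. pointwise in `t` for a real symmetric pencil), the definite-pair discriminant is non-negative. [this work] -/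
theorem definiteDisc_nonneg {S : Type*} [CommRing S] [LinearOrder S] [IsStrictOrderedRing S] {G : Matrix n n S} (hG : G.IsSymm)
    {i j : n} (hij : i ≠ j) :
    0 ≤ (G.adjugate i i + G.adjugate j j) ^ 2 -
        4 * G.det * ((G.updateRow i (Pi.single i (1 : S))).updateRow j (Pi.single j (1 : S))).det := by
  rw [definiteDisc_eq_sum_sq hG hij]
  positivity

end DefinitePair

end Summit.ValiantsHypothesis.ValiantsHypothesis.Theorems.KPlusLogSqLaw.TowerGraft
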